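import Mathlib
import HarnessLib
import Summits.ResolutionOfSingularities.ResolutionOfSingularities.Theorems.WildQuotientsWildQuotientResolutionS1KillExitDefs
import Literature.AlgebraicGeometry.Resolution.KiralyLutkebohmert

/-!
# Line L exit — (F1) part 2 of 3: §5 (F1-loc), the local frame lemma at a KILL point of an orbifold chart

[OURS · L1 W4.5c · idea-1 g10/g11] — NOT statements of the manuscript; counted 0. Part 2 of idea-1's module v2.1
(sha16 6124855f3ff3735d); the overview of all six sections is the module docstring of part 1 `…S1aLogExitFrames`.
Crux stmt-ResolutionOfSingularities-17941 (`WildQuotients.CyclicQuotientFourfolds`), line `s1a-logminvertex`, stub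
`stub_localGame` (EXIT half). This part: the **character cone** `charCone χ ⊆ ℤ^d` of a character vector
`χ : Fin d → ι` (`ι` a finite additive group) with its **character lattice** `charKer χ` and the REAL lattice lemmas
`charCone_fg`, `span_charCone_eq_charKer`, `charCone_saturated`, the WARNING `not_nsmulSaturated_charCone_example`;
the degree-`0` invariant subring `degZeroInvariants 𝒜 σ`; the named statements `F1Loc p` (frame-explicit local lemma,
WITH the (R-triv) binder — the binder-less shape is false, DVR witness in the docstring) and `F1LocExit p` (consumer
shape). Nothing is asserted.

FILING NOTE (lead-1 g6, LEAD1-GEN6-BRIEF A4): idea-1's module v2.1 (`L/res-L1-w45c-idea-1/f1/tree/…S1aLogExitFrames.lean`,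
sha16 6124855f3ff3735d, 799 lines, farm rc 0·0·0·0, tri-1 21:02:21Z PASS) exceeds the 399-line cap and is filed as THREE
files with declarations byte-identical and in the original order: part 1 `…S1aLogExitFrames` (§1–§4), part 2
`…S1aLogExitFramesCone` (§5), part 3 `…S1aLogExitFramesExit` (§6). All three share the namespace `…S1.LogExitFrames`.
Part 2 does not import part 1 (§5 uses nothing of §1–§4), so the two were filed in parallel; part 3 imports part 2.
-/

set_option linter.dupNamespace false

noncomputable section

open CategoryTheory AlgebraicGeometry TopologicalSpace
open Literature.AlgebraicGeometry.Resolution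

namespace Summit.ResolutionOfSingularities.ResolutionOfSingularities.Theorems.WildQuotientResolution.S1.LogExitFrames

/-! ## §5 (F1-loc): the local frame lemma at a KILL point of an orbifold chart (v2) -/

section CharCone

variable {ι : Type*} [AddCommGroup ι] {d : ℕ}

/-- The **character cone** `P_χ := {m ∈ ℤ^d | m ≥ 0, Σ_i m_i • χ_i = 0}` of a character vector
`χ : Fin d → ι` (`ι` = the character group of the stabiliser `μ′ ⊆ μ_{w_c}` at the KILL point; `χ_i` = the
character of the `i`-th homogeneous parameter `s_i` of the invariant ring): the exponents of the INVARIANT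
monomials `∏ s_i^{m_i}`. It is the chart monoid of the toric singularity of the quotient. (tri-1's `charCone`,
`reads19/F1LocSignature.lean` 09ac42f8c130e6af.) [OURS · L1 W4.5c] -/
def charCone (χ : Fin d → ι) : AddSubmonoid (Fin d → ℤ) where
  carrier := {m | (∀ i, 0 ≤ m i) ∧ ∑ i, m i • χ i = 0}
  zero_mem' := ⟨fun _ => le_rfl, by simp⟩
  add_mem' := by
    rintro a b ⟨ha, ha'⟩ ⟨hb, hb'⟩
    refine ⟨fun i => add_nonneg (ha i) (hb i), ?_⟩
    simp [Pi.add_apply, add_smul, Finset.sum_add_distrib, ha', hb']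

/-- Membership in the character cone: non-negative exponents with total character `0`. -/
@[simp] theorem mem_charCone_iff (χ : Fin d → ι) (m : Fin d → ℤ) :
    m ∈ charCone χ ↔ (∀ i, 0 ≤ m i) ∧ ∑ i, m i • χ i = 0 := Iff.rfl

/-- The **character lattice** `L_χ := {m ∈ ℤ^d | Σ_i m_i • χ_i = 0}`, the kernel of the character map
`ℤ^d → ι`; it has finite index in `ℤ^d` (it contains `|ι|·ℤ^d`) and is the group generated by the character
cone (`span_charCone_eq_charKer`). [OURS · L1 W4.5c] -/
def charKer (χ : Fin d → ι) : Submodule ℤ (Fin d → ℤ) :=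
  LinearMap.ker (Fintype.linearCombination ℤ χ)

/-- Membership in the character lattice: total character `0`. -/
@[simp] theorem mem_charKer_iff (χ : Fin d → ι) (m : Fin d → ℤ) :
    m ∈ charKer χ ↔ ∑ i, m i • χ i = 0 := by
  simp [charKer, Fintype.linearCombination_apply]

/-- The character cone lies in the character lattice. -/
theorem charCone_le_charKer (χ : Fin d → ι) : (charCone χ : Set (Fin d → ℤ)) ⊆ charKer χ :=
  fun m hm => (mem_charKer_iff χ m).2 hm.2

variable [Fintype ι]

/-- `|ι| • v` lies in the character lattice for every `v ∈ ℤ^d` (`|ι|` kills `ι`). [OURS · L1 W4.5c] -/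
theorem card_smul_mem_charKer (χ : Fin d → ι) (v : Fin d → ℤ) :
    (Fintype.card ι : ℤ) • v ∈ charKer χ := by
  rw [mem_charKer_iff]
  refine Finset.sum_eq_zero fun i _ => ?_
  rw [Pi.smul_apply, smul_eq_mul, mul_smul, natCast_zsmul, card_nsmul_eq_zero]

/-- `|ι| • v` lies in the character cone for every `v ≥ 0`. [OURS · L1 W4.5c] -/
theorem card_smul_mem_charCone (χ : Fin d → ι) {v : Fin d → ℤ} (hv : ∀ i, 0 ≤ v i) :
    (Fintype.card ι : ℤ) • v ∈ charCone χ :=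
  ⟨fun i => by rw [Pi.smul_apply, smul_eq_mul]; exact mul_nonneg (by positivity) (hv i),
    (mem_charKer_iff χ _).1 (card_smul_mem_charKer χ v)⟩

/-- In particular `|ι| • e_i ∈ P_χ`: the cone has full rank `d`. [OURS · L1 W4.5c] -/
theorem card_smul_single_mem_charCone (χ : Fin d → ι) (i : Fin d) :
    (Fintype.card ι : ℤ) • (Pi.single i 1 : Fin d → ℤ) ∈ charCone χ :=
  card_smul_mem_charCone χ fun j => by
    by_cases h : j = i
    · subst h; simp
    · simp [h]

/-- **Residue generators.** `P_χ` is generated by the `d` vectors `|ι| • e_i` together with the finitely many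
lattice points of the box `[0, |ι|)^d`: every `m ∈ P_χ` is `r + |ι| • q` with `r_i = m_i mod |ι|`,
`q_i = ⌊m_i / |ι|⌋ ≥ 0`, and `r ∈ P_χ` because `|ι| • q` is in the lattice. (Elementary substitute for Gordan's
lemma in this case.) [OURS · L1 W4.5c] -/
theorem charCone_eq_closure (χ : Fin d → ι) :
    charCone χ = AddSubmonoid.closure
      ((Set.range fun i : Fin d => (Fintype.card ι : ℤ) • (Pi.single i 1 : Fin d → ℤ)) ∪
        {r | (∀ i, 0 ≤ r i ∧ r i < (Fintype.card ι : ℤ)) ∧ ∑ i, r i • χ i = 0}) := by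
  set N : ℤ := ((Fintype.card ι : ℕ) : ℤ) with hNdef
  have hNpos : 0 < N := by
    have : 0 < Fintype.card ι := Fintype.card_pos_iff.mpr ⟨0⟩
    rw [hNdef]; exact_mod_cast this
  apply le_antisymm
  · intro m hm
    set q : Fin d → ℤ := fun i => m i / N with hqdef
    set r : Fin d → ℤ := fun i => m i % N with hrdef
    have hq : ∀ i, 0 ≤ q i := fun i => Int.ediv_nonneg (hm.1 i) hNpos.le
    have hr : r ∈ {r : Fin d → ℤ | (∀ i, 0 ≤ r i ∧ r i < (Fintype.card ι : ℤ)) ∧ ∑ i, r i • χ i = 0} := by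
      refine ⟨fun i => ⟨Int.emod_nonneg _ hNpos.ne', ?_⟩, ?_⟩
      · rw [← hNdef]; exact Int.emod_lt_of_pos _ hNpos
      · have hsub : ∀ i, r i = m i - N * q i := fun i => by
          rw [hrdef, hqdef]; simp only; rw [Int.emod_def]
        have hNq : ∑ i, (N * q i) • χ i = 0 := by
          simpa [Pi.smul_apply, smul_eq_mul] using (mem_charKer_iff χ _).1 (card_smul_mem_charKer χ q)
        calc ∑ i, r i • χ i = ∑ i, (m i • χ i - (N * q i) • χ i) := by
              refine Finset.sum_congr rfl fun i _ => ?_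
              rw [hsub, sub_smul]
          _ = 0 := by rw [Finset.sum_sub_distrib, hm.2, hNq, sub_zero]
    have hdec : m = r + ∑ i, (q i).toNat • (N • (Pi.single i 1 : Fin d → ℤ)) := by
      ext j
      rw [Pi.add_apply, Finset.sum_apply]
      simp only [Pi.smul_apply, Pi.single_apply, smul_ite, smul_zero, Finset.sum_ite_eq,
        Finset.mem_univ, if_true]
      rw [smul_eq_mul, mul_one, nsmul_eq_mul, Int.toNat_of_nonneg (hq j), hrdef, hqdef]
      linear_combination (Int.emod_add_mul_ediv (m j) N).symm
    have hgen : ∀ i : Fin d, N • (Pi.single i 1 : Fin d → ℤ) ∈ AddSubmonoid.closure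
        ((Set.range fun i : Fin d => N • (Pi.single i 1 : Fin d → ℤ)) ∪
          {r | (∀ i, 0 ≤ r i ∧ r i < N) ∧ ∑ i, r i • χ i = 0}) :=
      fun i => AddSubmonoid.subset_closure (Or.inl ⟨i, rfl⟩)
    rw [hdec]
    exact add_mem (AddSubmonoid.subset_closure (Or.inr hr))
      (sum_mem fun i _ => AddSubmonoid.nsmul_mem _ (hgen i) _)
  · rw [AddSubmonoid.closure_le]
    rintro m (⟨i, rfl⟩ | ⟨hm, hm'⟩)
    · exact card_smul_single_mem_charCone χ i
    · exact ⟨fun i => (hm i).1, hm'⟩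

/-- **`P_χ` is finitely generated** (an fs monoid needs `fg`: `LogAtlas.fg`). [OURS · L1 W4.5c] -/
theorem charCone_fg (χ : Fin d → ι) : (charCone χ).FG := by
  rw [AddSubmonoid.fg_iff]
  refine ⟨_, (charCone_eq_closure χ).symm, (Set.finite_range _).union ?_⟩
  refine (Set.Finite.pi fun _ : Fin d => Set.finite_Ico (0 : ℤ) (Fintype.card ι : ℤ)).subset ?_
  intro r hr
  exact Set.mem_univ_pi.2 fun i => ⟨(hr.1 i).1, (hr.1 i).2⟩

/-- **`P_χ^gp = L_χ`**: the character cone generates the character lattice as a group (every lattice vector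
is a difference of two cone vectors: `l = (l + |ι|•|l|) − |ι|•|l|`). So `P_χ` has rank `d`, but in general
does NOT span `ℤ^d` (`LogAtlas.span_eq_top` fails literally; re-present in a `ℤ`-basis of `L_χ`, `F1LocExit`).
[OURS · L1 W4.5c] -/
theorem span_charCone_eq_charKer (χ : Fin d → ι) :
    Submodule.span ℤ (charCone χ : Set (Fin d → ℤ)) = charKer χ := by
  apply le_antisymm
  · exact Submodule.span_le.2 (charCone_le_charKer χ)
  · intro l hl
    set N : ℤ := ((Fintype.card ι : ℕ) : ℤ) with hNdef
    have hN1 : 1 ≤ N := by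
      have : 0 < Fintype.card ι := Fintype.card_pos_iff.mpr ⟨0⟩
      rw [hNdef]; exact_mod_cast this
    set k : Fin d → ℤ := N • fun i => |l i| with hkdef
    have hk : k ∈ charCone χ := card_smul_mem_charCone χ fun i => abs_nonneg (l i)
    have hlk : l + k ∈ charCone χ := by
      refine ⟨fun i => ?_, ?_⟩
      · simp only [hkdef, Pi.add_apply, Pi.smul_apply, smul_eq_mul]
        nlinarith [neg_abs_le (l i), abs_nonneg (l i)]
      · exact (mem_charKer_iff χ _).1 (add_mem hl (card_smul_mem_charKer χ _))
    have : l = (l + k) - k := (add_sub_cancel_right l k).symm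
    rw [this]
    exact sub_mem (Submodule.subset_span hlk) (Submodule.subset_span hk)

omit [Fintype ι] in
/-- **`P_χ` is saturated inside its lattice `L_χ`**: `n • l ∈ P_χ`, `l ∈ L_χ`, `n ≠ 0` ⇒ `l ∈ P_χ`
(fs monoids are saturated; after re-presentation in a basis of `L_χ` this is `AddSubmonoid.NSMulSaturated`).
[OURS · L1 W4.5c] -/
theorem charCone_saturated (χ : Fin d → ι) {n : ℕ} (hn : n ≠ 0) {l : Fin d → ℤ}
    (hl : l ∈ charKer χ) (h : n • l ∈ charCone χ) : l ∈ charCone χ := by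
  refine ⟨fun i => ?_, (mem_charKer_iff χ l).1 hl⟩
  have hi := h.1 i
  rw [Pi.smul_apply, nsmul_eq_mul] at hi
  have hn' : (0 : ℤ) < n := by exact_mod_cast Nat.pos_of_ne_zero hn
  exact not_lt.1 fun hlt => absurd hi (not_le.2 (mul_neg_of_pos_of_neg hn' hlt))

omit [Fintype ι] in
/-- **WARNING (ambient saturation fails).** The character cone is in general NOT saturated in the ambient
`ℤ^d` in the sense of Mathlib's `AddSubmonoid.NSMulSaturated` (which is what the tree's `LogAtlas.saturated`
asks): for `ι = ZMod 2`, `d = 1`, `χ = 1` the cone is `2ℕ ⊆ ℤ`, `2 • e₀ ∈ P_χ` but `e₀ ∉ P_χ`. Hence the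
`LogAtlas` door needs the re-presentation `F1Loc → F1LocExit` (a `ℤ`-basis of `L_χ`), not the literal cone.
[OURS · L1 W4.5c] -/
theorem not_nsmulSaturated_charCone_example :
    ¬ (charCone (fun _ : Fin 1 => (1 : ZMod 2))).NSMulSaturated := by
  intro h
  have h2 : 2 • (fun _ : Fin 1 => (1 : ℤ)) ∈ charCone (fun _ : Fin 1 => (1 : ZMod 2)) := by
    refine ⟨fun i => by simp, ?_⟩
    simp only [Finset.univ_unique, Finset.sum_singleton, Pi.smul_apply]
    decide
  rcases h h2 with h0 | hmem
  · exact absurd h0 (by norm_num)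
  · have := hmem.2
    simp only [Finset.univ_unique, Finset.sum_singleton, one_smul] at this
    exact absurd this (by decide)

end CharCone

section LocStatement

/-- The **degree-`0` invariant subring** `R₀ := 𝒜 0 ⊓ B^σ` of a graded ring `B` with a ring automorphism
`σ`: for `B = B̃_{c,P̃}` (the complete / strictly henselian orbifold chart ring at a KILL point `P̃`, graded by
the characters of the stabiliser `μ′`) and `σ` the lifted `ℤ/p`-generator, `R₀` is the complete local ring of
the quotient `Y = V/G` at the image point. (tri-1's `degZeroFixed`; Mathlib `SetLike.GradeZero.subring` ⊓
Literature `invariantSubring`.) [OURS · L1 W4.5c] -/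
def degZeroInvariants {ι B : Type*} [AddMonoid ι] [CommRing B] (𝒜 : ι → AddSubgroup B)
    [SetLike.GradedMonoid 𝒜] (σ : B ≃+* B) : Subring B :=
  SetLike.GradeZero.subring 𝒜 ⊓ invariantSubring σ

/-- Membership in `degZeroInvariants 𝒜 σ`: degree `0` and `σ`-fixed. -/
theorem mem_degZeroInvariants_iff {ι B : Type*} [AddMonoid ι] [CommRing B] (𝒜 : ι → AddSubgroup B)
    [SetLike.GradedMonoid 𝒜] (σ : B ≃+* B) (b : B) :
    b ∈ degZeroInvariants 𝒜 σ ↔ b ∈ 𝒜 0 ∧ σ b = b :=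
  Iff.rfl

/-- **(F1-loc) LOCAL FRAME LEMMA at a KILL point, ring level, frame-explicit shape** (tri-1's `Statement p`,
`reads19/F1LocSignature.lean` 09ac42f8c130e6af, frame-lemma owner tri-1; re-typed over the Literature K–L
notions, WITH ONE ADDED HYPOTHESIS (R-triv), see below). Setting: `B` a regular local ring (the orbifold chart
ring at a KILL point `P̃`), graded by a FINITE additive group `ι` (`𝒜`, `GradedRing 𝒜`; `ι` = characters of
the stabiliser) with `|ι|` invertible in `B` ((I-T), explicit, as the owner asks) and **(R-triv): every
homogeneous element of non-zero degree is a non-unit** (`ι` is the character group of the INERTIA at `P̃`: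
the stabiliser acts trivially on the residue field — automatic when `B` is strictly henselian of residue
characteristic `> 0`, which is the owner's intended setting, but NOT encoded by the other binders); `σ` a
GRADED ring automorphism of prime order `p` in the Literature K–L shape (`σ^[p] = id`, `σ ≠ refl`) whose
`augmentationIdeal` is principal (KILL). Conclusion [C]+[D]: the K–L invariant ring `A = invariantSubring σ`
(regular local: `KiralyLutkebohmertRegularity`, PROVED in the tree as `KiralyLutkebohmertRegularity_holds`) has a
regular system of parameters of HOMOGENEOUS invariants `s₁,…,s_d` with characters `χ` (in coordinates
`(e, N(a), b♯_j)`), and the invariant-monomial chart `m ↦ ∏ s_i^{m_i}` of the character cone `charCone χ` into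
the degree-`0` invariant ring `R₀ = degZeroInvariants 𝒜 σ = A₀` is LOG REGULAR AT THE CLOSED POINT (Kato
(2.1), `LogChart.IsLogRegularLocal`; boundary = the `s_i` of non-trivial character; `charCone χ ⊆ ℤ^d` has
rank `d`, so the ambient-`n` rank term of `IsLogRegularLocal` is the right one although `P_χ^gp ≠ ℤ^d`).
WHY (R-triv) IS NEEDED — witness against the posted signature [OURS, hand computation, AI-level]: `k₀` of
characteristic `p` odd, `ι = ℤ/4`, `B = k₀(α, v)[[y]]` (a DVR) graded by `deg α = 0`, `deg v = 2`, `deg y = 1`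
(so the residue field `k₀(α,v) = k₀(α,v²) ⊕ v·k₀(α,v²)` is a graded field with support `{0,2}`: `v` is a
homogeneous UNIT of degree `2`), `σ` = Artin–Schreier on the coefficient `α ↦ α + 1` (graded, order `p`,
`≠ id`, augmentation ideal `= (1)`, principal); `|ι| = 4 ∈ B^×`, `𝔪_B = (y)` homogeneous. Then
`A = k₀(β, v)[[y]]` (`β = α^p − α`), `d = 1`, every homogeneous r.s.p. is `s₁ = u·y` with `deg u ∈ {0,2}`, so
`χ₁ ∈ {1,3}` and `charCone χ = 4ℕ`; `R₀ = A₀ = L₀[[Y]][Z]/(Z² − v²Y) = L₀[[Z]]` (`L₀ = k₀(β,v²)`, `Y = y⁴`,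
`Z = v y²`) is a DVR and Kato's ideal of the chart `4a ↦ s₁^{4a}` is `(s₁⁴) = (Z²) ≠ 𝔪_{R₀}`: `R₀/(Z²)` is not
reduced, so `¬ IsLogRegularLocal` for EVERY admissible `(s, χ)` (for `p = 2` take `ι = ℤ/9`, `deg v = 3`).
Root cause: `μ₄` fixes `P̃` only as a point; its inertia is `μ₂`, and graded by the inertia (`deg v = 0`) the
statement holds (`s₁ = y`, `P = 2ℕ`, `R₀' = k₀(β,v)[[y²]]`, Kato ideal `(y²) = 𝔪`). (R-triv) implies (H-hom)
`𝔪_B` homogeneous in one line (components of non-zero degree lie in `𝔪_B` by (R-triv), hence so does the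
degree-`0` component), so the (H-hom) binder of draft v2.0 is dropped.
PROOF ROUTE under (R-triv) [OURS, elementary, characteristic-free — no Cohen structure needed because
`IsLogRegularLocal` is the closed-point condition only]: (a) `A` regular local (K–L); `A = ⊕ A_c` with
`A_c = A ∩ B_c` (`σ` graded ⇒ components of an invariant are invariant), `𝔪_A = 𝔪_B ∩ A` homogeneous;
(b) graded Nakayama: `𝔪_A/𝔪_A²` is a graded `κ`-space (`κ = A₀/𝔪₀` by (R-triv)); lift homogeneous bases ⇒
homogeneous r.s.p. `s`, characters `χ` [C]; (c) `A` is a finite `A₀`-module and `A₀` is Noetherian local of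
dimension `d` (ACC for `A₀`-submodules `M ⊆ A_c` via `M = (M·A) ∩ A_c`; integrality `a^{|ι|} ∈ A₀`);
(d) DEGREE WALK: for `a ∈ 𝔪_A ∩ A₀` write `a = Σ a_i s_i` and project to degree `0`, iterate on the
coefficients of non-zero degree (they lie in `𝔪_A` by (R-triv)); every monomial reaching degree `0` is
`s^m` with `m ∈ charCone χ ∖ 0`, the remainder after `k` steps lies in `𝔪_A^k ∩ A₀ ⊆ 𝔪_{A₀}^{g(k)}`,
`g → ∞`; Krull ⇒ Kato's ideal `I = (s^m : m ∈ P_χ ∖ 0)·A₀` equals `𝔪_{A₀}`, so `A₀/I = κ` is regular of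
dimension `0`, the unit face is `{0}` and `dim A₀ = d = 0 + (d − 0)` [D]. CAVEAT (F1-loc-c), not typed: at a
NON-rational KILL point whose stabiliser `D` is bigger than its inertia `I`, the quotient's local ring is
`R₀^{D/I}` (a free = étale `D/I`-quotient under (I-T)); its Zariski chart is a RESCALED monomial frame
(the twisting cocycle is abelian on the free group `P_χ^gp`, hence a coboundary) — a separate descent remark
for the consumer, not part of this statement. Mixed characteristic: covered by the route above (tri-1's
(F1-loc-b) Cohen caveat concerns only the finer structure theorem, not (2.1) at the closed point).
Why it might fail: only through a mis-typing of the graded/K–L interface; the mathematics is (a)–(d).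
[OURS · L1 W4.5c] -/
def F1Loc (p : ℕ) : Prop :=
  p.Prime →
  ∀ (ι : Type) [AddCommGroup ι] [Fintype ι] [DecidableEq ι] (B : Type) [CommRing B] [IsRegularLocalRing B]
    (𝒜 : ι → AddSubgroup B) [GradedRing 𝒜] (σ : B ≃+* B),
    IsUnit ((Fintype.card ι : ℕ) : B) →
    (∀ c : ι, c ≠ 0 → ∀ b ∈ 𝒜 c, b ∈ IsLocalRing.maximalIdeal B) →
    (∀ c : ι, ∀ b ∈ 𝒜 c, σ b ∈ 𝒜 c) →
    (∀ b : B, (⇑σ)^[p] b = b) → σ ≠ RingEquiv.refl B →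
    (augmentationIdeal σ).IsPrincipal →
    ∃ (d : ℕ) (_ : IsLocalRing (invariantSubring σ)) (s : Fin d → invariantSubring σ) (χ : Fin d → ι),
      (∀ i, ((s i : invariantSubring σ) : B) ∈ 𝒜 (χ i)) ∧
      ringKrullDim (invariantSubring σ) = d ∧
      Ideal.span (Set.range s) = IsLocalRing.maximalIdeal (invariantSubring σ) ∧
      ∃ (_ : IsLocalRing (degZeroInvariants 𝒜 σ))
        (φ : Multiplicative (charCone χ) →* degZeroInvariants 𝒜 σ),
        (∀ m : charCone χ, ((φ (Multiplicative.ofAdd m) : degZeroInvariants 𝒜 σ) : B) =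
            ∏ i, ((s i : invariantSubring σ) : B) ^ ((m : Fin d → ℤ) i).toNat) ∧
        LogChart.IsLogRegularLocal (charCone χ) φ

/-- **(F1-loc) in CONSUMER (atlas) shape** (tri-1's `ExitShape p`, plus the same (R-triv) binder): under the
binders of `F1Loc`, the degree-`0` invariant ring `R₀` carries SOME chart monoid `P ⊆ ℤ^r` with EXACTLY the
three fields of the tree's `LogAtlas`
(`fg`, `saturated` = Mathlib `AddSubmonoid.NSMulSaturated` in the ambient `ℤ^r`, `span_eq_top`) and a chart
`φ : P → R₀` log regular at the closed point — what `logExitZone_of_logAtlas` (§1) eats chart by chart.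
`F1Loc p → F1LocExit p` is the re-presentation of `charCone χ` in a `ℤ`-basis of the lattice `charKer χ`
(`span_charCone_eq_charKer`, finite index in `ℤ^d`; `fg`/`saturated` by `charCone_fg`/`charCone_saturated`;
`IsLogRegularLocal` sees only Kato's ideal, the unit face and `rank = d`, all transported) — load-bearing by
`not_nsmulSaturated_charCone_example`; PROVED in §6 (`f1LocExit_of_f1Loc`, with `r = d`). Junk audit (tri-1): the trivial
monoid `r = 0` witnesses `F1LocExit` only when `R₀` is regular (Kato (2.2)(1), `isLogRegularLocal_zero_iff`),
a legitimate empty-boundary exit. [OURS · L1 W4.5c] -/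
def F1LocExit (p : ℕ) : Prop :=
  p.Prime →
  ∀ (ι : Type) [AddCommGroup ι] [Fintype ι] [DecidableEq ι] (B : Type) [CommRing B] [IsRegularLocalRing B]
    (𝒜 : ι → AddSubgroup B) [GradedRing 𝒜] (σ : B ≃+* B),
    IsUnit ((Fintype.card ι : ℕ) : B) →
    (∀ c : ι, c ≠ 0 → ∀ b ∈ 𝒜 c, b ∈ IsLocalRing.maximalIdeal B) →
    (∀ c : ι, ∀ b ∈ 𝒜 c, σ b ∈ 𝒜 c) →
    (∀ b : B, (⇑σ)^[p] b = b) → σ ≠ RingEquiv.refl B →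
    (augmentationIdeal σ).IsPrincipal →
    ∃ (_ : IsLocalRing (degZeroInvariants 𝒜 σ)) (r : ℕ) (P : AddSubmonoid (Fin r → ℤ)),
      P.FG ∧ P.NSMulSaturated ∧ Submodule.span ℤ (P : Set (Fin r → ℤ)) = ⊤ ∧
      ∃ φ : Multiplicative P →* degZeroInvariants 𝒜 σ, LogChart.IsLogRegularLocal P φ

end LocStatement

end Summit.ResolutionOfSingularities.ResolutionOfSingularities.Theorems.WildQuotientResolution.S1.LogExitFrames

end
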